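import Summits.CriticalPhenomena.PercolationContinuityZ3.Theorems.PercNearOneGluingNearOneGluingR3ppOfS12

/-!
# Crux `PercNearOneGluing.NearOneGluing` (stmt-CriticalPhenomena-4574), line `SketchR2I5` —
# the first-order transport inequality behind the exchange slack `S1`

Lead prover-line-stmt-CriticalPhenomena-4574-c8 (cycle 8, wave 1, stub-worker on `stub_exchS1`).  Lands
`--supports stmt-CriticalPhenomena-4574`; no definitions, no named facts.

## Content

Finite weighted graph on `Fin n`, `μ = prodBernoulli w`, `{u ↔ v} = openConn u v`, `C_v(ω) = openEdgeCluster ω v`.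
Notation of the line: `D := {y ↮ z}`, `D_a := {x ↮ y} ∩ {x ↮ z}`, `W := D_a ∩ {o ↔ x}`,
`θ := μ(W)/μ(D_a) = P(o ↔ x | x ↮ y, x ↮ z)`, `ν := Law(C_y ; D)`.

The registered open stub `stub_exchS1` (S1) is the up-set `U = {b ∈ C_y}` of the residual
`Cov_D(1{o ∈ C_y} − θ·1{x ∈ C_y}, 1_U(C_y)) ≥ 0` (S1-gen), whose Strassen form (crux NOTES c8) asks for
an upward transport of `θ·ν|{x ∈ C}` plus a multiple of `ν` onto `ν|{o ∈ C}`.  This file proves the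
**first-order half** of that transport (the part without the covariance correction), for EVERY
event `U` increasing in the open edge cluster of `y`:

  `μ(W) · μ({x↔y} ∩ U ∩ D) ≤ μ(D_a) · μ({o↔y} ∩ {x↔y} ∩ U ∩ D)`      (`exchS1_firstOrder`),

i.e. `θ · ν(x ∈ C ∈ U) ≤ ν(o ∈ C, x ∈ C, C ∈ U)`: the measure `θ·ν|{x∈C}` is dominated on up-sets by
`ν|{o,x ∈ C}` (so, by max-flow/min-cut on the finite cluster poset, it can be transported upward
into it).  With `U = univ` this sharpens the landed `r3pp_t1` (`θ·ν(x∈C) ≤ ν(o∈C)`); with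
`U = {y↔b}` it is the domination of the main term of S1,
`μ(W)μ({x↔y}∩{y↔b}∩D) ≤ μ(D_a)μ({o↔y}∩{x↔y}∩{y↔b}∩D)` (`exchS1_firstOrder_yb`).

Proof.  On `{x ↔ y}` one has `{y ↮ z} = {x ↮ z}`, `{o ↔ y} = {o ↔ x}` and `C_y = C_x`, so every
event is an event of the cluster `C_x` avoided by `z`: with `E := {x ↮ z}`, `A := {x ↔ o}`,
`B := {x ↔ y}`, the claim reads `μ(E∩A∩Bᶜ)·μ(E∩B∩U) ≤ μ(E∩Bᶜ)·μ(E∩A∩B∩U)`.  van den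
Berg–Häggström–Kahn's Thm. 1.3 (conditional positive association of `C_x` given `x ↮ z`, tree lemma
`knLemma3i_oneCluster`) gives `μ(E∩A)μ(E∩B) ≤ μ(E)μ(E∩A∩B)` and
`μ(E∩A)μ(E∩B∩U) ≤ μ(E)μ(E∩A∩B∩U)` (`B ∩ U` is increasing in `C_x` because `C_x = C_y` on `B`);
the first is `P(A | E, Bᶜ) ≤ P(A | E)`, the second `P(A | E) ≤ P(A | E, B ∩ U)`, and the product of
the two is the claim.
[cite: VandenbergHaggstromKahn2005, Thm. 1.3 (p. 6)] [cite: KozmaNitzan2024, Question 7 (p. 36)]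
-/

namespace Summit.CriticalPhenomena.PercolationContinuityZ3.Theorems

open MeasureTheory Set Literature.Probability.LatticeModels Literature.Probability.Percolation
open scoped Classical
open Q7ThreeCut

noncomputable section

variable {n : ℕ}

/-- Two joined vertices have the same open edge cluster. [folklore] -/
theorem exS1_openEdgeCluster_eq_of_conn {ω : BondConfig (Fin n)} {u v : Fin n}
    (h : ω ∈ (openConn u v : Set (BondConfig (Fin n)))) : openEdgeCluster ω u = openEdgeCluster ω v := by
  ext e
  simp only [mem_openEdgeCluster_iff]
  exact and_congr_right fun _ => and_congr_right fun _ =>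
    forall₂_congr fun z _ =>
      ⟨fun hz => SimpleGraph.Reachable.trans (SimpleGraph.Reachable.symm h) hz,
        fun hz => SimpleGraph.Reachable.trans h hz⟩

/-- If `U` is increasing in `C_y` then `{x ↔ y} ∩ U` is increasing in `C_x` (on `{x ↔ y}`, `C_x = C_y`).
[folklore] -/
theorem exS1_xyU_mono (x y : Fin n) (U : Set (BondConfig (Fin n)))
    (hU : ∀ ω ω', ω ∈ U → openEdgeCluster ω y ⊆ openEdgeCluster ω' y → ω' ∈ U) :
    ∀ ω ω', ω ∈ (openConn x y ∩ U : Set (BondConfig (Fin n))) →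
      openEdgeCluster ω x ⊆ openEdgeCluster ω' x → ω' ∈ (openConn x y ∩ U : Set (BondConfig (Fin n))) := by
  rintro ω ω' ⟨hxy, hωU⟩ hsub
  have hxy' : ω' ∈ (openConn x y : Set (BondConfig (Fin n))) :=
    pivDom_openConn_mono_openEdgeCluster x y ω ω' hxy hsub
  refine ⟨hxy', hU ω ω' hωU ?_⟩
  rw [← exS1_openEdgeCluster_eq_of_conn hxy, ← exS1_openEdgeCluster_eq_of_conn hxy']
  exact hsub

/-- **First-order transport inequality** (`θ·ν|{x∈C} ≤ ν|{o,x∈C}` on up-sets).  For every event `U`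
increasing in the open edge cluster of `y` and `x ≠ z`:
`μ(W)·μ({x↔y} ∩ U ∩ {y↮z}) ≤ μ(D_a)·μ({o↔y} ∩ {x↔y} ∩ U ∩ {y↮z})`,
`W = {x↮y} ∩ {x↮z} ∩ {o↔x}`, `D_a = {x↮y} ∩ {x↮z}`.  Two applications of van den Berg–Häggström–Kahn's
Thm. 1.3 to the cluster of `x` given `x ↮ z`. [cite: VandenbergHaggstromKahn2005, Thm. 1.3 (p. 6)] -/
theorem exchS1_firstOrder (w : Sym2 (Fin n) → unitInterval) (o x y z : Fin n)
    (U : Set (BondConfig (Fin n)))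
    (hU : ∀ ω ω', ω ∈ U → openEdgeCluster ω y ⊆ openEdgeCluster ω' y → ω' ∈ U) (hxz : x ≠ z) :
    (prodBernoulli w).real (((openConn x y)ᶜ ∩ (openConn x z)ᶜ) ∩ openConn o x) *
        (prodBernoulli w).real (openConn x y ∩ U ∩ (openConn y z)ᶜ) ≤
      (prodBernoulli w).real ((openConn x y)ᶜ ∩ (openConn x z)ᶜ) *
        (prodBernoulli w).real (openConn o y ∩ openConn x y ∩ U ∩ (openConn y z)ᶜ) := by
  set μ := prodBernoulli w with hμ
  -- BHK Thm. 1.3, source `x`, avoided `{z}`, `f = 1{x↔o}`: with `Q = {x↔y}` and `Q = {x↔y} ∩ U`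
  have bhk1 := knLemma3i_oneCluster w x z o (openConn x y) (pivDom_openConn_mono_openEdgeCluster x y) hxz
  have bhk2 := knLemma3i_oneCluster w x z o (openConn x y ∩ U) (exS1_xyU_mono x y U hU) hxz
  have hxo : (openConn x o : Set (BondConfig (Fin n))) = openConn o x := by
    ext η; exact ⟨fun h => conn_symm h, fun h => conn_symm h⟩
  rw [hxo] at bhk1 bhk2
  -- names: `e = μ(E)`, `ea = μ(E∩A)`, `eb = μ(E∩B)`, `eab = μ(E∩A∩B)`, `P = μ(E∩B∩U)`, `Q = μ(E∩A∩B∩U)`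
  -- `μ(D_a) = e − eb`, `μ(W) = ea − eab`
  have e1 : μ.real ((openConn x y)ᶜ ∩ (openConn x z)ᶜ : Set (BondConfig (Fin n))) =
      μ.real (openConn x z : Set (BondConfig (Fin n)))ᶜ -
        μ.real ((openConn x z)ᶜ ∩ openConn x y : Set (BondConfig (Fin n))) := by
    have h := measureReal_inter_add_sdiff (μ := μ) (s := (openConn x z : Set (BondConfig (Fin n)))ᶜ)
      (t := openConn x y) MeasurableSet.of_discrete
    have hs : (openConn x z : Set (BondConfig (Fin n)))ᶜ \ openConn x y =
        (openConn x y)ᶜ ∩ (openConn x z)ᶜ := by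
      ext ω; simp only [mem_sdiff, mem_compl_iff, mem_inter_iff]; tauto
    rw [hs] at h
    linarith
  have e2 : μ.real (((openConn x y)ᶜ ∩ (openConn x z)ᶜ) ∩ openConn o x : Set (BondConfig (Fin n))) =
      μ.real ((openConn x z)ᶜ ∩ openConn o x : Set (BondConfig (Fin n))) -
        μ.real ((openConn x z)ᶜ ∩ (openConn o x ∩ openConn x y) : Set (BondConfig (Fin n))) := by
    have h := measureReal_inter_add_sdiff (μ := μ)
      (s := ((openConn x z)ᶜ ∩ openConn o x : Set (BondConfig (Fin n)))) (t := openConn x y)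
      MeasurableSet.of_discrete
    have hs1 : ((openConn x z)ᶜ ∩ openConn o x : Set (BondConfig (Fin n))) ∩ openConn x y =
        (openConn x z)ᶜ ∩ (openConn o x ∩ openConn x y) := inter_assoc _ _ _
    have hs2 : ((openConn x z)ᶜ ∩ openConn o x : Set (BondConfig (Fin n))) \ openConn x y =
        ((openConn x y)ᶜ ∩ (openConn x z)ᶜ) ∩ openConn o x := by
      ext ω; simp only [mem_sdiff, mem_compl_iff, mem_inter_iff]; tauto
    rw [hs1, hs2] at h
    linarith
  -- `{x↔y} ∩ U ∩ D = E ∩ ({x↔y} ∩ U)` and `{o↔y} ∩ {x↔y} ∩ U ∩ D = E ∩ ({o↔x} ∩ ({x↔y} ∩ U))`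
  have e3 : (openConn x y ∩ U ∩ (openConn y z)ᶜ : Set (BondConfig (Fin n))) =
      (openConn x z)ᶜ ∩ (openConn x y ∩ U) := by
    ext ω
    simp only [mem_inter_iff, mem_compl_iff]
    constructor
    · rintro ⟨⟨hxy, hU'⟩, hyz⟩
      exact ⟨fun hxz' => hyz (conn_trans (conn_symm hxy) hxz'), hxy, hU'⟩
    · rintro ⟨hxz', hxy, hU'⟩
      exact ⟨⟨hxy, hU'⟩, fun hyz => hxz' (conn_trans hxy hyz)⟩
  have e4 : (openConn o y ∩ openConn x y ∩ U ∩ (openConn y z)ᶜ : Set (BondConfig (Fin n))) =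
      (openConn x z)ᶜ ∩ (openConn o x ∩ (openConn x y ∩ U)) := by
    ext ω
    simp only [mem_inter_iff, mem_compl_iff]
    constructor
    · rintro ⟨⟨⟨hoy, hxy⟩, hU'⟩, hyz⟩
      exact ⟨fun hxz' => hyz (conn_trans (conn_symm hxy) hxz'), conn_trans hoy (conn_symm hxy), hxy, hU'⟩
    · rintro ⟨hxz', hox, hxy, hU'⟩
      exact ⟨⟨⟨conn_trans hox hxy, hxy⟩, hU'⟩, fun hyz => hxz' (conn_trans hxy hyz)⟩
  rw [e1, e2, e3, e4]
  -- abbreviate the six probabilities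
  set e := μ.real (openConn x z : Set (BondConfig (Fin n)))ᶜ with he
  set ea := μ.real ((openConn x z)ᶜ ∩ openConn o x : Set (BondConfig (Fin n))) with hea
  set eb := μ.real ((openConn x z)ᶜ ∩ openConn x y : Set (BondConfig (Fin n))) with heb
  set eab := μ.real ((openConn x z)ᶜ ∩ (openConn o x ∩ openConn x y) : Set (BondConfig (Fin n))) with heab
  set P := μ.real ((openConn x z)ᶜ ∩ (openConn x y ∩ U) : Set (BondConfig (Fin n))) with hP
  set Q := μ.real ((openConn x z)ᶜ ∩ (openConn o x ∩ (openConn x y ∩ U)) : Set (BondConfig (Fin n))) with hQ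
  -- (a) `e·(ea − eab) ≤ ea·(e − eb)` from `bhk1 : ea·eb ≤ e·eab`; (b) `ea·P ≤ e·Q` is `bhk2`
  have hP0 : 0 ≤ P := measureReal_nonneg
  have hQ0 : 0 ≤ Q := measureReal_nonneg
  have hea0 : 0 ≤ ea := measureReal_nonneg
  have hDa0 : 0 ≤ e - eb := by
    rw [heb, he]; exact sub_nonneg.2 (measureReal_mono inter_subset_left)
  have hW0 : 0 ≤ ea - eab := by
    rw [heab, hea]
    exact sub_nonneg.2 (measureReal_mono (inter_subset_inter_right _ inter_subset_left))
  have hWle : ea - eab ≤ e := by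
    have h1 : ea ≤ e := by rw [hea, he]; exact measureReal_mono inter_subset_left
    have h2 : 0 ≤ eab := measureReal_nonneg
    linarith
  -- `e · [(ea − eab)·P] ≤ e · [(e − eb)·Q]`
  have key : e * ((ea - eab) * P) ≤ e * ((e - eb) * Q) := by
    have ha : e * (ea - eab) ≤ ea * (e - eb) := by nlinarith [bhk1]
    have h1 : e * (ea - eab) * P ≤ ea * (e - eb) * P := mul_le_mul_of_nonneg_right ha hP0
    have h2 : ea * P * (e - eb) ≤ e * Q * (e - eb) := mul_le_mul_of_nonneg_right bhk2 hDa0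
    nlinarith [h1, h2]
  by_cases he0 : e = 0
  · -- then `μ(W) ≤ μ(E) = 0`
    have hW : ea - eab = 0 := le_antisymm (he0 ▸ hWle) hW0
    rw [hW, zero_mul]
    exact mul_nonneg hDa0 hQ0
  · have hepos : 0 < e := lt_of_le_of_ne measureReal_nonneg (Ne.symm he0)
    exact le_of_mul_le_mul_left key hepos

/-- The case `U = {y ↔ b}` of `exchS1_firstOrder`: the main term of the exchange slack S1 is dominated,
`μ(W)·μ({x↔y} ∩ {y↔b} ∩ {y↮z}) ≤ μ(D_a)·μ({o↔y} ∩ {x↔y} ∩ {y↔b} ∩ {y↮z})`.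
[cite: VandenbergHaggstromKahn2005, Thm. 1.3 (p. 6)] -/
theorem exchS1_firstOrder_yb (w : Sym2 (Fin n) → unitInterval) (o b x y z : Fin n) (hxz : x ≠ z) :
    (prodBernoulli w).real (((openConn x y)ᶜ ∩ (openConn x z)ᶜ) ∩ openConn o x) *
        (prodBernoulli w).real (openConn x y ∩ openConn y b ∩ (openConn y z)ᶜ) ≤
      (prodBernoulli w).real ((openConn x y)ᶜ ∩ (openConn x z)ᶜ) *
        (prodBernoulli w).real (openConn o y ∩ openConn x y ∩ openConn y b ∩ (openConn y z)ᶜ) :=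
  exchS1_firstOrder w o x y z (openConn y b) (pivDom_openConn_mono_openEdgeCluster y b) hxz


/-! ### Functional form (monotone nonnegative test functions of `C_y`) -/

/-- On `{x ↔ y} ∩ {y ↮ z}` = `{x ↮ z} ∩ {x ↔ y}`. [folklore] -/
theorem exS1_xyD_eq (x y z : Fin n) :
    (openConn x y ∩ (openConn y z)ᶜ : Set (BondConfig (Fin n))) = (openConn x z)ᶜ ∩ openConn x y := by
  ext ω
  simp only [mem_inter_iff, mem_compl_iff]
  constructor
  · rintro ⟨hxy, hyz⟩
    exact ⟨fun hxz' => hyz (conn_trans (conn_symm hxy) hxz'), hxy⟩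
  · rintro ⟨hxz', hxy⟩
    exact ⟨hxy, fun hyz => hxz' (conn_trans hxy hyz)⟩

/-- `{o↔y} ∩ {x↔y} ∩ {y↮z} = {x↮z} ∩ ({x↔o} ∩ {x↔y})`. [folklore] -/
theorem exS1_oyxyD_eq (o x y z : Fin n) :
    (openConn o y ∩ openConn x y ∩ (openConn y z)ᶜ : Set (BondConfig (Fin n))) =
      (openConn x z)ᶜ ∩ (openConn x o ∩ openConn x y) := by
  ext ω
  simp only [mem_inter_iff, mem_compl_iff]
  constructor
  · rintro ⟨⟨hoy, hxy⟩, hyz⟩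
    exact ⟨fun hxz' => hyz (conn_trans (conn_symm hxy) hxz'), conn_trans hxy (conn_symm hoy), hxy⟩
  · rintro ⟨hxz', hxo, hxy⟩
    exact ⟨⟨conn_trans (conn_symm hxo) hxy, hxy⟩, fun hyz => hxz' (conn_trans hxy hyz)⟩

/-- **First-order transport inequality, functional form.**  For `G` monotone and nonnegative on edge
sets and `x ≠ z`:
`μ(W) · ∫_{{x↔y} ∩ D} G(C_y) dμ ≤ μ(D_a) · ∫_{{o↔y} ∩ {x↔y} ∩ D} G(C_y) dμ`  (`D = {y ↮ z}`),
i.e. `θ · ∫_{x ∈ C_y} G(C_y) dν ≤ ∫_{o, x ∈ C_y} G(C_y) dν` for `ν = μ(· ∩ D)`.  van den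
Berg–Häggström–Kahn Thm. 1.3 for the cluster of `x` given `x ↮ z`, with `f = 1{x↔o}` and
`g = 1{x↔y}·G(C_x)` resp. `g = 1{x↔y}`. [cite: VandenbergHaggstromKahn2005, Thm. 1.3 (p. 6)] -/
theorem exchS1_firstOrder_fn (w : Sym2 (Fin n) → unitInterval) (o x y z : Fin n)
    (G : Set (Sym2 (Fin n)) → ℝ) (hG : Monotone G) (hG0 : ∀ C, 0 ≤ G C) (hxz : x ≠ z) :
    (prodBernoulli w).real (((openConn x y)ᶜ ∩ (openConn x z)ᶜ) ∩ openConn o x) *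
        (∫ ω in openConn x y ∩ (openConn y z)ᶜ, G (openEdgeCluster ω y) ∂(prodBernoulli w)) ≤
      (prodBernoulli w).real ((openConn x y)ᶜ ∩ (openConn x z)ᶜ) *
        (∫ ω in openConn o y ∩ openConn x y ∩ (openConn y z)ᶜ, G (openEdgeCluster ω y)
          ∂(prodBernoulli w)) := by
  set μ := prodBernoulli w with hμ
  -- the increasing function `g(C) = F_y(C) · G(C)` of the edge set
  set g : Set (Sym2 (Fin n)) → ℝ := fun C => connIndicatorFn x y C * G C with hg
  have hFy01 : ∀ C, connIndicatorFn x y C = 0 ∨ connIndicatorFn x y C = 1 := by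
    intro C; unfold connIndicatorFn; split_ifs
    · exact Or.inr rfl
    · exact Or.inl rfl
  have hFy0 : ∀ C, 0 ≤ connIndicatorFn x y C := by
    intro C; rcases hFy01 C with h | h <;> rw [h]
    exact zero_le_one
  have hgm : Monotone g := by
    intro C C' hCC'
    simp only [hg]
    exact mul_le_mul (monotone_connIndicatorFn x y hCC') (hG hCC') (hG0 C) (hFy0 C')
  -- BHK Thm. 1.3 for `C_x` given `x ↮ z`: with `g` and with `F_y`
  have key := BHK2006_clusterConditionalPositiveAssociation_holds (Fin n) w x ({z} : Set (Fin n))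
    (connIndicatorFn x o) g (monotone_connIndicatorFn x o) hgm
    (fun h => hxz (Set.mem_singleton_iff.1 h))
  have bhk1 := knLemma3i_oneCluster w x z o (openConn x y) (pivDom_openConn_mono_openEdgeCluster x y) hxz
  have hD : {ω : BondConfig (Fin n) | ∀ y' ∈ ({z} : Set (Fin n)), ¬ (openGraph ω).Reachable x y'} =
      (openConn x z)ᶜ := by
    ext ω
    simp only [Set.mem_setOf_eq, Set.mem_singleton_iff, forall_eq, Set.mem_compl_iff]
    rfl
  rw [hD] at key
  -- evaluate the three integrals in `key`
  have hmE : MeasurableSet ((openConn x z)ᶜ : Set (BondConfig (Fin n))) := MeasurableSet.of_discrete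
  have hmo : MeasurableSet (openConn x o : Set (BondConfig (Fin n))) := MeasurableSet.of_discrete
  have hmy : MeasurableSet (openConn x y : Set (BondConfig (Fin n))) := MeasurableSet.of_discrete
  -- (1) `∫_E F_o(C_x) = μ(E ∩ {x↔o})`
  have i1 : ∫ ω in (openConn x z)ᶜ, connIndicatorFn x o (openEdgeCluster ω x) ∂μ =
      μ.real ((openConn x z)ᶜ ∩ openConn x o) := by
    simp only [connIndicatorFn_openEdgeCluster]
    rw [setIntegral_indicator hmo]
    simp only [Pi.one_apply, setIntegral_const, smul_eq_mul, mul_one]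
  -- pointwise: `g(C_x ω) = 1_{x↔y}(ω) · G(C_y ω)`
  have hgpt : ∀ ω : BondConfig (Fin n), g (openEdgeCluster ω x) =
      (openConn x y).indicator (fun ω => G (openEdgeCluster ω y)) ω := by
    intro ω
    simp only [hg, connIndicatorFn_openEdgeCluster]
    by_cases hxy : ω ∈ (openConn x y : Set (BondConfig (Fin n)))
    · rw [indicator_of_mem hxy, indicator_of_mem hxy, Pi.one_apply, one_mul,
        exS1_openEdgeCluster_eq_of_conn hxy]
    · rw [indicator_of_notMem hxy, indicator_of_notMem hxy, zero_mul]
  -- (2) `∫_E g(C_x) = ∫_{{x↔y} ∩ D} G(C_y)`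
  have i2 : ∫ ω in (openConn x z)ᶜ, g (openEdgeCluster ω x) ∂μ =
      ∫ ω in openConn x y ∩ (openConn y z)ᶜ, G (openEdgeCluster ω y) ∂μ := by
    simp only [hgpt]
    rw [setIntegral_indicator hmy, exS1_xyD_eq x y z]
  -- (3) `∫_E F_o(C_x) g(C_x) = ∫_{{o↔y} ∩ {x↔y} ∩ D} G(C_y)`
  have i3 : ∫ ω in (openConn x z)ᶜ, connIndicatorFn x o (openEdgeCluster ω x) * g (openEdgeCluster ω x) ∂μ =
      ∫ ω in openConn o y ∩ openConn x y ∩ (openConn y z)ᶜ, G (openEdgeCluster ω y) ∂μ := by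
    have hpt : ∀ ω : BondConfig (Fin n),
        connIndicatorFn x o (openEdgeCluster ω x) * g (openEdgeCluster ω x) =
          (openConn x o ∩ openConn x y).indicator (fun ω => G (openEdgeCluster ω y)) ω := by
      intro ω
      rw [hgpt ω, connIndicatorFn_openEdgeCluster]
      by_cases hxo : ω ∈ (openConn x o : Set (BondConfig (Fin n)))
      · by_cases hxy : ω ∈ (openConn x y : Set (BondConfig (Fin n)))
        · rw [indicator_of_mem hxo, indicator_of_mem hxy, indicator_of_mem (mem_inter hxo hxy),
            Pi.one_apply, one_mul]
        · rw [indicator_of_notMem hxy, mul_zero, indicator_of_notMem (fun h => hxy h.2)]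
      · rw [indicator_of_notMem hxo, zero_mul, indicator_of_notMem (fun h => hxo h.1)]
    simp only [hpt]
    rw [setIntegral_indicator (hmo.inter hmy), exS1_oyxyD_eq o x y z]
  rw [i1, i2, i3] at key
  -- the algebra, as in `exchS1_firstOrder`
  have hxo : (openConn x o : Set (BondConfig (Fin n))) = openConn o x := by
    ext η; exact ⟨fun h => conn_symm h, fun h => conn_symm h⟩
  rw [hxo] at bhk1 key
  have e1 : μ.real ((openConn x y)ᶜ ∩ (openConn x z)ᶜ : Set (BondConfig (Fin n))) =
      μ.real (openConn x z : Set (BondConfig (Fin n)))ᶜ -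
        μ.real ((openConn x z)ᶜ ∩ openConn x y : Set (BondConfig (Fin n))) := by
    have h := measureReal_inter_add_sdiff (μ := μ) (s := (openConn x z : Set (BondConfig (Fin n)))ᶜ)
      (t := openConn x y) MeasurableSet.of_discrete
    have hs : (openConn x z : Set (BondConfig (Fin n)))ᶜ \ openConn x y =
        (openConn x y)ᶜ ∩ (openConn x z)ᶜ := by
      ext ω; simp only [mem_sdiff, mem_compl_iff, mem_inter_iff]; tauto
    rw [hs] at h
    linarith
  have e2 : μ.real (((openConn x y)ᶜ ∩ (openConn x z)ᶜ) ∩ openConn o x : Set (BondConfig (Fin n))) =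
      μ.real ((openConn x z)ᶜ ∩ openConn o x : Set (BondConfig (Fin n))) -
        μ.real ((openConn x z)ᶜ ∩ (openConn o x ∩ openConn x y) : Set (BondConfig (Fin n))) := by
    have h := measureReal_inter_add_sdiff (μ := μ)
      (s := ((openConn x z)ᶜ ∩ openConn o x : Set (BondConfig (Fin n)))) (t := openConn x y)
      MeasurableSet.of_discrete
    have hs1 : ((openConn x z)ᶜ ∩ openConn o x : Set (BondConfig (Fin n))) ∩ openConn x y =
        (openConn x z)ᶜ ∩ (openConn o x ∩ openConn x y) := inter_assoc _ _ _
    have hs2 : ((openConn x z)ᶜ ∩ openConn o x : Set (BondConfig (Fin n))) \ openConn x y =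
        ((openConn x y)ᶜ ∩ (openConn x z)ᶜ) ∩ openConn o x := by
      ext ω; simp only [mem_sdiff, mem_compl_iff, mem_inter_iff]; tauto
    rw [hs1, hs2] at h
    linarith
  rw [e1, e2]
  set e := μ.real (openConn x z : Set (BondConfig (Fin n)))ᶜ with he
  set ea := μ.real ((openConn x z)ᶜ ∩ openConn o x : Set (BondConfig (Fin n))) with hea
  set eb := μ.real ((openConn x z)ᶜ ∩ openConn x y : Set (BondConfig (Fin n))) with heb
  set eab := μ.real ((openConn x z)ᶜ ∩ (openConn o x ∩ openConn x y) : Set (BondConfig (Fin n))) with heab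
  set I := ∫ ω in openConn x y ∩ (openConn y z)ᶜ, G (openEdgeCluster ω y) ∂μ with hI
  set J := ∫ ω in openConn o y ∩ openConn x y ∩ (openConn y z)ᶜ, G (openEdgeCluster ω y) ∂μ with hJ
  have hI0 : 0 ≤ I := setIntegral_nonneg MeasurableSet.of_discrete fun ω _ => hG0 _
  have hJ0 : 0 ≤ J := setIntegral_nonneg MeasurableSet.of_discrete fun ω _ => hG0 _
  have hea0 : 0 ≤ ea := measureReal_nonneg
  have hDa0 : 0 ≤ e - eb := by
    rw [heb, he]; exact sub_nonneg.2 (measureReal_mono inter_subset_left)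
  have hW0 : 0 ≤ ea - eab := by
    rw [heab, hea]
    exact sub_nonneg.2 (measureReal_mono (inter_subset_inter_right _ inter_subset_left))
  have hWle : ea - eab ≤ e := by
    have h1 : ea ≤ e := by rw [hea, he]; exact measureReal_mono inter_subset_left
    have h2 : 0 ≤ eab := measureReal_nonneg
    linarith
  have keyI : e * ((ea - eab) * I) ≤ e * ((e - eb) * J) := by
    have ha : e * (ea - eab) ≤ ea * (e - eb) := by nlinarith [bhk1]
    have h1 : e * (ea - eab) * I ≤ ea * (e - eb) * I := mul_le_mul_of_nonneg_right ha hI0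
    have h2 : ea * I * (e - eb) ≤ e * J * (e - eb) := mul_le_mul_of_nonneg_right key hDa0
    nlinarith [h1, h2]
  by_cases he0 : e = 0
  · have hW : ea - eab = 0 := le_antisymm (he0 ▸ hWle) hW0
    rw [hW, zero_mul]
    exact mul_nonneg hDa0 hJ0
  · have hepos : 0 < e := lt_of_le_of_ne measureReal_nonneg (Ne.symm he0)
    exact le_of_mul_le_mul_left keyI hepos

end

end Summit.CriticalPhenomena.PercolationContinuityZ3.Theorems
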